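import Mathlib
import HarnessLib
import Summits.NavierStokesRegularity.NavierStokesRegularity.Theorems.HalfSpaceWindowDoorCirculationCarryingRigidityGaussExtremalStretching
import Summits.NavierStokesRegularity.NavierStokesRegularity.Theorems.HalfSpaceWindowDoorCirculationCarryingRigidityGaussExtremalCentering
import Summits.NavierStokesRegularity.NavierStokesRegularity.Theorems.HalfSpaceWindowDoorCirculationCarryingRigidityGaussExtremalSecondOrder

/-!
# Route `HalfSpaceWindowDoor`, crux `CirculationCarryingRigidity` (stmt-NavierStokesRegularity-25311) —
# the JOINT EXTREMAL SYSTEM (first AND second order) for ONE Gaussian-extremal profile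

LEAD ns-hsw-p1 g8 (cell pub-ns-dss), `--supports stmt-NavierStokesRegularity-25311 --as helper`.  The census files
`…GaussExtremalConditions/Moments/Centering` (g7), `…Hessian/TiltingSharp/Stretching/SecondOrder` (g8) each produce SOME extremal `W` with
SOME of the conditions; the disprover's target (card `Lines/blowdown.md` §Next (c)) is ONE `W` carrying ALL of them.  Here the derivations
are made DETERMINISTIC in the raw extremality data of `exists_gaussExtremal'` (`Λ = 𝒢(1;0)[W(−1)] > 0` maximal over every `σ < 0`,
`0 < t ≤ −σ`, `y₀`; `ℐ(1;0)[W(−1)] = −2Λ`): `firstOrder_of_extremal` ((E0)–(E3): `Θ(1,0) > 0`, axis/scale maximality, `−Θ ≤ ΔΘ ≤ 0`,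
`ℐ = −2·(4π)^{3/2}·2·Θ`), `moments_of_extremal` (`M₀ > 0`, directional moments `≤ 2‖e‖²M₀`, coordinates `≤ 2M₀`, horizontal `≤ 4M₀`,
`2M₀ ≤ ∫‖y‖²G₁ω₃ ≤ 6M₀`, centering, (E3)), `tilting_of_extremal` (`𝒜 − 𝒯 = −2M₀`, `|𝒜| ≤ 2CM₀`, `(2∓2C)M₀` window, `∫G₁g = 2M₀`,
`𝒯 = 𝒮 − ½𝒵`), and `circulationCarryingRigidity_of_joint`: the crux follows once NO single closed-hemisphere door-class `W` carries all
three packages together with the classical Navier–Stokes form of `∂ₜW` and the SECOND-ORDER condition of `…SecondOrder` (the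
Gaussian-extremal profile of any enemy of W6 does).  WHAT THIS IS NOT: not a statement about Navier–Stokes regularity; door statements
concern HYPOTHETICAL blow-up profiles (KNSS ancient mild solutions).  No item is closed by this file.
-/

noncomputable section

-- the summit and its single sub-problem share the name (CONVENTIONS §1), as in every Theorems file
set_option linter.dupNamespace false

namespace Summit.NavierStokesRegularity.NavierStokesRegularity.Theorems.HalfSpaceWindowDoorCirculationCarryingRigidityGaussExtremalJoint

open MeasureTheory Set Function Filter Topology
open scoped RealInnerProductSpace InnerProductSpace Laplacian
open Literature.Analysis Literature.Analysis.FluidPDE Literature.Analysis.UnboundedOperators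
open Summit.NavierStokesRegularity.NavierStokesRegularity.Theses.HalfSpaceWindowDoor
open Summit.NavierStokesRegularity.NavierStokesRegularity.Theorems.HalfSpaceWindowDoorCirculationCarryingRigidityDefs
open Summit.NavierStokesRegularity.NavierStokesRegularity.Theorems.HalfSpaceWindowDoorCirculationCarryingRigidityReduction
  (circulationCarryingRigidity_of_hemisphereLiouvilleE3)
open Summit.NavierStokesRegularity.NavierStokesRegularity.Theorems.HalfSpaceWindowDoorCirculationCarryingRigidityGaussKernel
  (inner_e3_apply)
open Summit.NavierStokesRegularity.NavierStokesRegularity.Theorems.HalfSpaceWindowDoorCirculationCarryingRigidityGaussCirculation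
  (integral_G_angMom_eq)
open Summit.NavierStokesRegularity.NavierStokesRegularity.Theorems.HalfSpaceWindowDoorCirculationCarryingRigidityGaussSwirlLaw
  (gaussianInflowIdentity_holds)
open Summit.NavierStokesRegularity.NavierStokesRegularity.Theorems.HalfSpaceWindowDoorCirculationCarryingRigidityGaussExtremalConditions
  (gaussAngMom_eq_heatExtension omega3_continuous_bounded heatKernel_sub_comm)
open Summit.NavierStokesRegularity.NavierStokesRegularity.Theorems.HalfSpaceWindowDoorCirculationCarryingRigidityGaussExtremalTilting
  (slice_components abs_horiz_dot_le abs_horiz_dot_le_two)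
open Summit.NavierStokesRegularity.NavierStokesRegularity.Theorems.HalfSpaceWindowDoorCirculationCarryingRigidityGaussExtremalHessian
  (directionalMoment_le_of_axisMax inner_single_one_eq)
open Summit.NavierStokesRegularity.NavierStokesRegularity.Theorems.HalfSpaceWindowDoorCirculationCarryingRigidityGaussExtremalTiltingSharp
  (abs_horiz_dot_le_quad)
open Summit.NavierStokesRegularity.NavierStokesRegularity.Theorems.HalfSpaceWindowDoorCirculationCarryingRigidityGaussExtremalStretching
  (gaussTilting_eq_stretching)
open Summit.NavierStokesRegularity.NavierStokesRegularity.Theorems.HalfSpaceWindowDoorCirculationCarryingRigidityGaussExtremalCentering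
  (integral_heatKernel_inner_mul_eq_zero_of_axisMax)
open Summit.NavierStokesRegularity.NavierStokesRegularity.Theorems.HalfSpaceWindowDoorCirculationCarryingRigidityGaussExtremalSecondOrder
  (gaussExtremal_secondOrder)
open Summit.NavierStokesRegularity.NavierStokesRegularity.Theorems.LocalSineTubeDoorProfileAlignedWindowRigidityAncient
  (bdd_of_hasTypeITimeDecay analyticOnNhd_slice)
open Summit.NavierStokesRegularity.NavierStokesRegularity.Theorems.PoloidalWindowDoorPoloidalWindowRigidityClassSpaceTimeRates
  (exists_fderiv_rate_of_class')

variable {C : ℝ} {W : ℝ → EuclideanSpace ℝ (Fin 3) → EuclideanSpace ℝ (Fin 3)}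

/-- **First-order system of a Gaussian-extremal profile** (the derivation of `…GaussExtremalConditions.gaussExtremal_conditions`, made
deterministic in `W`): class + `Λ = 𝒢(1;0)[W(−1)] > 0` maximal over all `σ < 0`, `0 < t ≤ −σ`, `y₀` + `ℐ(1;0)[W(−1)] = −2Λ` ⇒ with
`Θ(t,·) = e^{tΔ}ω`, `ω = ⟪curl W(−1), e₃⟫`: `Θ(1,0) > 0`, `Θ(1,y) ≤ Θ(1,0)`, `tΘ(t,0) ≤ Θ(1,0)` (`0 < t ≤ 1`), `ΔΘ(1,·)(0) ≤ 0`,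
`Θ(1,0) + ΔΘ(1,·)(0) ≥ 0`, `ℐ(1;0)[W(−1)] = −2·(4π)^{3/2}·2·Θ(1,0)`. -/
theorem firstOrder_of_extremal (hW : InDoorClass C W) (hΛ : 0 < gaussAngMom 1 0 (W (-1)))
    (hmax : ∀ σ < 0, ∀ t : ℝ, 0 < t → t ≤ -σ → ∀ y₀, gaussAngMom t y₀ (W σ) ≤ gaussAngMom 1 0 (W (-1)))
    (hI : gaussInflow 1 0 (W (-1)) = -2 * gaussAngMom 1 0 (W (-1))) :
    0 < heatExtension (fun x => ⟪curl (W (-1)) x, e3⟫) 1 0 ∧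
      (∀ y, heatExtension (fun x => ⟪curl (W (-1)) x, e3⟫) 1 y ≤ heatExtension (fun x => ⟪curl (W (-1)) x, e3⟫) 1 0) ∧
      (∀ t : ℝ, 0 < t → t ≤ 1 →
        t * heatExtension (fun x => ⟪curl (W (-1)) x, e3⟫) t 0 ≤ heatExtension (fun x => ⟪curl (W (-1)) x, e3⟫) 1 0) ∧
      (Δ (heatExtension (fun x => ⟪curl (W (-1)) x, e3⟫) 1)) 0 ≤ 0 ∧
      0 ≤ heatExtension (fun x => ⟪curl (W (-1)) x, e3⟫) 1 0 + (Δ (heatExtension (fun x => ⟪curl (W (-1)) x, e3⟫) 1)) 0 ∧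
      gaussInflow 1 0 (W (-1)) = -2 * ((4 * Real.pi) ^ ((3 : ℝ) / 2) * 2 * heatExtension (fun x => ⟪curl (W (-1)) x, e3⟫) 1 0) := by
  set ω : EuclideanSpace ℝ (Fin 3) → ℝ := fun x => ⟪curl (W (-1)) x, e3⟫ with hω
  have hm1 : (-1 : ℝ) < 0 := by norm_num
  obtain ⟨hωc, B, hωB⟩ := omega3_continuous_bounded hW hm1
  set c : ℝ := (4 * Real.pi) ^ ((3 : ℝ) / 2) * 2 with hc
  have hc0 : 0 < c := by positivity
  have hdict : ∀ t : ℝ, 0 < t → ∀ y₀, gaussAngMom t y₀ (W (-1)) = c * t * heatExtension ω t y₀ := by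
    intro t ht y₀
    rw [gaussAngMom_eq_heatExtension hW hm1 ht y₀, hc]; ring
  have hΘpos : 0 < heatExtension ω 1 0 := by
    have h := hΛ
    rw [hdict 1 one_pos 0, mul_one] at h
    exact (mul_pos_iff_of_pos_left hc0).1 h
  have haxis : ∀ y, heatExtension ω 1 y ≤ heatExtension ω 1 0 := by
    intro y
    have h := hmax (-1) hm1 1 one_pos (by norm_num) y
    rw [hdict 1 one_pos y, hdict 1 one_pos 0, mul_one] at h
    exact le_of_mul_le_mul_left h hc0
  have hscale : ∀ t : ℝ, 0 < t → t ≤ 1 → t * heatExtension ω t 0 ≤ heatExtension ω 1 0 := by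
    intro t ht ht1
    have h := hmax (-1) hm1 t ht (by norm_num; exact ht1) 0
    rw [hdict t ht 0, hdict 1 one_pos 0, mul_one, mul_assoc] at h
    exact le_of_mul_le_mul_left h hc0
  have hC2 : ContDiff ℝ 2 (heatExtension ω 1) := contDiff_heatExtension_of_bound hωc hωB one_pos
  have hlocmax : IsLocalMax (heatExtension ω 1) 0 := Eventually.of_forall fun y => haxis y
  have hlap : (Δ (heatExtension ω 1)) 0 ≤ 0 := hlocmax.laplacian_nonpos hC2
  have hderΘ : HasDerivAt (fun t => heatExtension ω t 0) ((Δ (heatExtension ω 1)) 0) 1 :=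
    hasDerivAt_heatExtension_time one_pos (memLp_top_of_continuous_of_bound hωc hωB) le_top 0
  have hderG : HasDerivAt (fun t => t * heatExtension ω t 0)
      (1 * heatExtension ω 1 0 + 1 * (Δ (heatExtension ω 1)) 0) 1 := (hasDerivAt_id' (1 : ℝ)).mul hderΘ
  have hscale' : 0 ≤ 1 * heatExtension ω 1 0 + 1 * (Δ (heatExtension ω 1)) 0 := by
    refine Summit.NavierStokesRegularity.NavierStokesRegularity.Theorems.HalfSpaceWindowDoorCirculationCarryingRigidityGaussExtremalConditions.deriv_nonneg_of_max_right
      hderG fun t ht ht1 => ?_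
    rw [one_mul]
    exact hscale t ht ht1
  rw [one_mul, one_mul] at hscale'
  have hI' : gaussInflow 1 0 (W (-1)) = -2 * (c * heatExtension ω 1 0) := by
    rw [hI, hdict 1 one_pos 0, mul_one]
  exact ⟨hΘpos, haxis, hscale, hlap, hscale', hI'⟩

/-- **Moment package of a Gaussian-extremal profile** (deterministic): `M₀ = ∫G₁ω₃ > 0`; directional moments `≤ 2‖e‖²M₀`; coordinates
`∫yᵢ²G₁ω₃ ≤ 2M₀`; horizontal `≤ 4M₀`; `2M₀ ≤ ∫‖y‖²G₁ω₃ ≤ 6M₀`; centering `∫G₁⟪y,v⟫ω₃ = 0`; `ℐ(1;0)[W(−1)] = −2·(4π)^{3/2}·2·M₀`. -/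
theorem moments_of_extremal (hW : InDoorClass C W) (hΛ : 0 < gaussAngMom 1 0 (W (-1)))
    (hmax : ∀ σ < 0, ∀ t : ℝ, 0 < t → t ≤ -σ → ∀ y₀, gaussAngMom t y₀ (W σ) ≤ gaussAngMom 1 0 (W (-1)))
    (hI : gaussInflow 1 0 (W (-1)) = -2 * gaussAngMom 1 0 (W (-1))) :
    0 < ∫ y, heatKernel 1 y * curl (W (-1)) y 2 ∧
      (∀ e : EuclideanSpace ℝ (Fin 3),
        ∫ y, ⟪y, e⟫ ^ 2 * heatKernel 1 y * curl (W (-1)) y 2 ≤ 2 * ‖e‖ ^ 2 * ∫ y, heatKernel 1 y * curl (W (-1)) y 2) ∧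
      (∀ i : Fin 3, ∫ y, (y i) ^ 2 * heatKernel 1 y * curl (W (-1)) y 2 ≤ 2 * ∫ y, heatKernel 1 y * curl (W (-1)) y 2) ∧
      ∫ y, ((y 0) ^ 2 + (y 1) ^ 2) * heatKernel 1 y * curl (W (-1)) y 2 ≤ 4 * ∫ y, heatKernel 1 y * curl (W (-1)) y 2 ∧
      2 * ∫ y, heatKernel 1 y * curl (W (-1)) y 2 ≤ ∫ y, ‖y‖ ^ 2 * heatKernel 1 y * curl (W (-1)) y 2 ∧
      ∫ y, ‖y‖ ^ 2 * heatKernel 1 y * curl (W (-1)) y 2 ≤ 6 * ∫ y, heatKernel 1 y * curl (W (-1)) y 2 ∧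
      (∀ u : EuclideanSpace ℝ (Fin 3), ∫ y, heatKernel 1 y * ⟪y, u⟫ * curl (W (-1)) y 2 = 0) ∧
      gaussInflow 1 0 (W (-1)) = -2 * ((4 * Real.pi) ^ ((3 : ℝ) / 2) * 2 * ∫ y, heatKernel 1 y * curl (W (-1)) y 2) := by
  obtain ⟨h0, haxis, -, hlap, hsc, hI'⟩ := firstOrder_of_extremal hW hΛ hmax hI
  set ω : EuclideanSpace ℝ (Fin 3) → ℝ := fun x => ⟪curl (W (-1)) x, e3⟫ with hω
  have hm1 : (-1 : ℝ) < 0 := by norm_num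
  obtain ⟨hωc', B, hωB'⟩ := omega3_continuous_bounded hW hm1
  have hωc : Continuous ω := hωc'
  have hωB : ∀ x, ‖ω x‖ ≤ B := hωB'
  have hΘ : heatExtension ω 1 0 = ∫ y, heatKernel 1 y * ω y := by
    rw [heatExtension_eq_integral_mul]
    congr 1; funext z; rw [heatKernel_sub_comm, sub_zero]
  have hΔ : (Δ (heatExtension ω 1)) 0 = ∫ y, (‖y‖ ^ 2 / 4 - 3 / 2) * (heatKernel 1 y * ω y) := by
    rw [laplacian_heatExtension_eq_integral one_pos (memLp_top_of_continuous_of_bound hωc hωB) le_top 0]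
    congr 1; funext y
    rw [heatKernel_sub_comm, sub_zero, zero_sub, norm_neg, finrank_euclideanSpace_fin, smul_eq_mul]
    push_cast
    ring
  have hint0 : Integrable (fun y : EuclideanSpace ℝ (Fin 3) => heatKernel 1 y * ω y) :=
    ((integrable_heatKernel_holds (E := EuclideanSpace ℝ (Fin 3)) one_pos).bdd_mul hωc.aestronglyMeasurable
      (ae_of_all _ fun x => hωB x)).congr (ae_of_all _ fun x => by simp [mul_comm])
  have hint2 : Integrable (fun y : EuclideanSpace ℝ (Fin 3) => ‖y‖ ^ 2 * heatKernel 1 y * ω y) :=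
    ((integrable_norm_sq_mul_heatKernel (E := EuclideanSpace ℝ (Fin 3)) one_pos).bdd_mul hωc.aestronglyMeasurable
      (ae_of_all _ fun x => hωB x)).congr (ae_of_all _ fun x => by simp only; ring)
  have hsplit : ∫ y, (‖y‖ ^ 2 / 4 - 3 / 2) * (heatKernel 1 y * ω y) =
      (1 / 4) * (∫ y, ‖y‖ ^ 2 * heatKernel 1 y * ω y) - (3 / 2) * (∫ y, heatKernel 1 y * ω y) := by
    have heq : (fun y : EuclideanSpace ℝ (Fin 3) => (‖y‖ ^ 2 / 4 - 3 / 2) * (heatKernel 1 y * ω y)) =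
        fun y => (1 / 4) * (‖y‖ ^ 2 * heatKernel 1 y * ω y) - (3 / 2) * (heatKernel 1 y * ω y) := by
      funext y; ring
    rw [heq, integral_sub (hint2.const_mul _) (hint0.const_mul _), integral_const_mul, integral_const_mul]
  have hdir : ∀ e : EuclideanSpace ℝ (Fin 3), ∫ y, ⟪y, e⟫ ^ 2 * heatKernel 1 y * ω y ≤ 2 * ‖e‖ ^ 2 * ∫ y, heatKernel 1 y * ω y :=
    fun e => directionalMoment_le_of_axisMax hωc hωB haxis e
  have hcent : ∀ u : EuclideanSpace ℝ (Fin 3), ∫ y, heatKernel 1 y * ⟪y, u⟫ * ω y = 0 := fun u =>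
    integral_heatKernel_inner_mul_eq_zero_of_axisMax hW haxis u
  rw [hΘ] at h0 hsc hI'
  rw [hΔ, hsplit] at hlap hsc
  have hωe : ∀ y, ω y = curl (W (-1)) y 2 := fun y => inner_e3_apply _
  simp only [hωe] at h0 hsc hI' hlap hdir hcent
  have hcoord : ∀ i : Fin 3, ∫ y, (y i) ^ 2 * heatKernel 1 y * curl (W (-1)) y 2 ≤ 2 * ∫ y, heatKernel 1 y * curl (W (-1)) y 2 := by
    intro i
    have h := hdir (EuclideanSpace.single i (1 : ℝ))
    have hn : ‖EuclideanSpace.single i (1 : ℝ)‖ = 1 := by simp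
    simp_rw [inner_single_one_eq, hn] at h
    simpa using h
  obtain ⟨-, -, hωcc, K, hωK⟩ := slice_components hW hm1
  have hG1c : Continuous fun y : EuclideanSpace ℝ (Fin 3) => heatKernel 1 y := by unfold heatKernel; fun_prop
  have hcont_yi : ∀ i : Fin 3, Continuous fun y : EuclideanSpace ℝ (Fin 3) => y i := fun i =>
    (continuous_apply i).comp (PiLp.continuous_ofLp 2 _)
  have hint2' : Integrable (fun y : EuclideanSpace ℝ (Fin 3) => ‖y‖ ^ 2 * heatKernel 1 y * curl (W (-1)) y 2) :=
    hint2.congr (ae_of_all _ fun y => by simp only [hωe])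
  have hinti : ∀ i : Fin 3, Integrable (fun y : EuclideanSpace ℝ (Fin 3) => (y i) ^ 2 * heatKernel 1 y * curl (W (-1)) y 2) := by
    intro i
    refine hint2'.mono ((((hcont_yi i).pow 2).mul hG1c).mul (hωcc 2)).aestronglyMeasurable (ae_of_all _ fun y => ?_)
    have hG : 0 ≤ heatKernel 1 y := (heatKernel_pos one_pos _).le
    have hyi : (y i) ^ 2 ≤ ‖y‖ ^ 2 := by
      have h : |y i| ≤ ‖y‖ := by rw [← Real.norm_eq_abs]; exact PiLp.norm_apply_le y i
      have h' := pow_le_pow_left₀ (abs_nonneg _) h 2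
      rwa [sq_abs] at h'
    rw [Real.norm_eq_abs, abs_mul, abs_mul, abs_of_nonneg (sq_nonneg (y i)), abs_of_nonneg hG, Real.norm_eq_abs, abs_mul, abs_mul,
      abs_of_nonneg (sq_nonneg ‖y‖), abs_of_nonneg hG]
    gcongr
  have hhor : ∫ y, ((y 0) ^ 2 + (y 1) ^ 2) * heatKernel 1 y * curl (W (-1)) y 2 =
      (∫ y, (y 0) ^ 2 * heatKernel 1 y * curl (W (-1)) y 2) + ∫ y, (y 1) ^ 2 * heatKernel 1 y * curl (W (-1)) y 2 := by
    rw [← integral_add (hinti 0) (hinti 1)]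
    congr 1; funext y; ring
  have h0' := hcoord 0
  have h1' := hcoord 1
  refine ⟨h0, hdir, hcoord, by rw [hhor]; linarith, by linarith, by linarith, hcent, hI'⟩


/-- **Tilting package of a Gaussian-extremal profile** (deterministic; the derivations of `…TiltingSharp` and `…Stretching`): with
`u = W(−1)`, `M₀ = ∫G₁ω₃`, `𝒜 = ∫G₁(x_h·u_h)ω₃`, `𝒯 = ∫G₁(x_h·ω_h)u₃`, `g = angMom 0 u`: `𝒜 − 𝒯 = −2M₀`, `|𝒜| ≤ 2C·M₀`,
`(2−2C)M₀ ≤ 𝒯 ≤ (2+2C)M₀`, `∫G₁g = 2M₀`, and `𝒯 = ∫G₁g∂₂u₂ − ½∫G₁x₂u₂g`. -/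
theorem tilting_of_extremal (hW : InDoorClass C W) (hWs : SignE3 W) (hΛ : 0 < gaussAngMom 1 0 (W (-1)))
    (hmax : ∀ σ < 0, ∀ t : ℝ, 0 < t → t ≤ -σ → ∀ y₀, gaussAngMom t y₀ (W σ) ≤ gaussAngMom 1 0 (W (-1)))
    (hI : gaussInflow 1 0 (W (-1)) = -2 * gaussAngMom 1 0 (W (-1))) :
    (∫ y, heatKernel 1 y * ((y 0 * W (-1) y 0 + y 1 * W (-1) y 1) * curl (W (-1)) y 2)) -
        (∫ y, heatKernel 1 y * ((y 0 * curl (W (-1)) y 0 + y 1 * curl (W (-1)) y 1) * W (-1) y 2)) =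
      -2 * ∫ y, heatKernel 1 y * curl (W (-1)) y 2 ∧
    |∫ y, heatKernel 1 y * ((y 0 * W (-1) y 0 + y 1 * W (-1) y 1) * curl (W (-1)) y 2)| ≤
      2 * C * ∫ y, heatKernel 1 y * curl (W (-1)) y 2 ∧
    (2 - 2 * C) * ∫ y, heatKernel 1 y * curl (W (-1)) y 2 ≤
      ∫ y, heatKernel 1 y * ((y 0 * curl (W (-1)) y 0 + y 1 * curl (W (-1)) y 1) * W (-1) y 2) ∧
    ∫ y, heatKernel 1 y * ((y 0 * curl (W (-1)) y 0 + y 1 * curl (W (-1)) y 1) * W (-1) y 2) ≤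
      (2 + 2 * C) * ∫ y, heatKernel 1 y * curl (W (-1)) y 2 ∧
    ∫ y, heatKernel 1 y * angMom 0 (W (-1)) y = 2 * ∫ y, heatKernel 1 y * curl (W (-1)) y 2 ∧
    ∫ y, heatKernel 1 y * ((y 0 * curl (W (-1)) y 0 + y 1 * curl (W (-1)) y 1) * W (-1) y 2) =
      (∫ y, heatKernel 1 y * (angMom 0 (W (-1)) y * fderiv ℝ (W (-1)) y (EuclideanSpace.single 2 1) 2)) -
        1 / 2 * ∫ y, heatKernel 1 y * (y 2 * W (-1) y 2 * angMom 0 (W (-1)) y) := by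
  obtain ⟨h0, -, -, hhor, -, -, -, hI'⟩ := moments_of_extremal hW hΛ hmax hI
  have hm1 : (-1 : ℝ) < 0 := by norm_num
  set M₀ : ℝ := ∫ y, heatKernel 1 y * curl (W (-1)) y 2 with hM₀
  set Mh : ℝ := ∫ y, ((y 0) ^ 2 + (y 1) ^ 2) * heatKernel 1 y * curl (W (-1)) y 2 with hMh
  obtain ⟨hvc, -, hωc, K, hωK⟩ := slice_components hW hm1
  have hvC : ∀ x, ‖W (-1) x‖ ≤ C := fun x => by
    have h := hW.1 (-1) hm1 x; rwa [neg_neg, Real.sqrt_one, div_one] at h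
  have hC0 : 0 ≤ C := (norm_nonneg _).trans (hvC 0)
  have hK0 : 0 ≤ K := (abs_nonneg _).trans (hωK 0 0)
  have hv2 : ∀ x, |W (-1) x 2| ≤ C := fun x =>
    ((Real.norm_eq_abs _).symm.le.trans (PiLp.norm_apply_le (W (-1) x) 2)).trans (hvC x)
  have hω3nn : ∀ x, 0 ≤ curl (W (-1)) x 2 := fun x => by rw [← inner_e3_apply]; exact hWs (-1) hm1 x
  have hO1b := gaussianInflowIdentity_holds C W hW 0 1 (-1) one_pos hm1
  simp only [sub_zero, mul_one] at hO1b
  set A : ℝ := ∫ y, heatKernel 1 y * ((y 0 * W (-1) y 0 + y 1 * W (-1) y 1) * curl (W (-1)) y 2) with hA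
  set T : ℝ := ∫ y, heatKernel 1 y * ((y 0 * curl (W (-1)) y 0 + y 1 * curl (W (-1)) y 1) * W (-1) y 2) with hT
  have hmom1 : Integrable (fun y : EuclideanSpace ℝ (Fin 3) => heatKernel 1 y * ‖y‖) :=
    integrable_heatKernel_mul_norm (E := EuclideanSpace ℝ (Fin 3)) one_pos
  have hcont_yi : ∀ i : Fin 3, Continuous fun y : EuclideanSpace ℝ (Fin 3) => y i := fun i =>
    (continuous_apply i).comp (PiLp.continuous_ofLp 2 _)
  have hG1c : Continuous fun y : EuclideanSpace ℝ (Fin 3) => heatKernel 1 y := by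
    unfold heatKernel; fun_prop
  have hintA : Integrable (fun y : EuclideanSpace ℝ (Fin 3) =>
      heatKernel 1 y * ((y 0 * W (-1) y 0 + y 1 * W (-1) y 1) * curl (W (-1)) y 2)) := by
    refine Integrable.mono' (hmom1.const_mul (C * K)) ?_ (ae_of_all _ fun y => ?_)
    · exact (hG1c.mul ((((hcont_yi 0).mul (hvc 0)).add ((hcont_yi 1).mul (hvc 1))).mul (hωc 2))).aestronglyMeasurable
    · have hG : 0 ≤ heatKernel 1 y := (heatKernel_pos one_pos _).le
      rw [Real.norm_eq_abs, abs_mul, abs_of_nonneg hG, abs_mul]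
      calc heatKernel 1 y * (|y 0 * W (-1) y 0 + y 1 * W (-1) y 1| * |curl (W (-1)) y 2|)
          ≤ heatKernel 1 y * ((‖y‖ * C) * K) :=
            mul_le_mul_of_nonneg_left (mul_le_mul (abs_horiz_dot_le y (W (-1) y) (hvC y)) (hωK 2 y) (abs_nonneg _) (by positivity)) hG
        _ = C * K * (heatKernel 1 y * ‖y‖) := by ring
  have hintT : Integrable (fun y : EuclideanSpace ℝ (Fin 3) =>
      heatKernel 1 y * ((y 0 * curl (W (-1)) y 0 + y 1 * curl (W (-1)) y 1) * W (-1) y 2)) := by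
    refine Integrable.mono' (hmom1.const_mul (2 * K * C)) ?_ (ae_of_all _ fun y => ?_)
    · exact (hG1c.mul ((((hcont_yi 0).mul (hωc 0)).add ((hcont_yi 1).mul (hωc 1))).mul (hvc 2))).aestronglyMeasurable
    · have hG : 0 ≤ heatKernel 1 y := (heatKernel_pos one_pos _).le
      rw [Real.norm_eq_abs, abs_mul, abs_of_nonneg hG, abs_mul]
      calc heatKernel 1 y * (|y 0 * curl (W (-1)) y 0 + y 1 * curl (W (-1)) y 1| * |W (-1) y 2|)
          ≤ heatKernel 1 y * ((2 * K * ‖y‖) * C) :=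
            mul_le_mul_of_nonneg_left (mul_le_mul (abs_horiz_dot_le_two y (curl (W (-1)) y) (fun i => hωK i y)) (hv2 y)
              (abs_nonneg _) (by positivity)) hG
        _ = 2 * K * C * (heatKernel 1 y * ‖y‖) := by ring
  have hsplit : ∫ x : EuclideanSpace ℝ (Fin 3), heatKernel 1 x *
      (x 0 * (W (-1) x 0 * curl (W (-1)) x 2 - curl (W (-1)) x 0 * W (-1) x 2) +
        x 1 * (W (-1) x 1 * curl (W (-1)) x 2 - curl (W (-1)) x 1 * W (-1) x 2)) = A - T := by
    rw [hA, hT, ← integral_sub hintA hintT]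
    congr 1; funext x; ring
  rw [hsplit] at hO1b
  have hc : 0 < (4 * Real.pi) ^ ((3 : ℝ) / 2) * 2 := by positivity
  have hAT : A - T = -2 * M₀ := by
    have h' : (4 * Real.pi) ^ ((3 : ℝ) / 2) * 2 * (A - T) = (4 * Real.pi) ^ ((3 : ℝ) / 2) * 2 * (-2 * M₀) := by
      rw [← hO1b, hI']; ring
    exact mul_left_cancel₀ hc.ne' h'
  have hint0 : Integrable (fun y : EuclideanSpace ℝ (Fin 3) => heatKernel 1 y * curl (W (-1)) y 2) := by
    obtain ⟨hωc', B, hωB'⟩ := omega3_continuous_bounded hW hm1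
    have h := ((integrable_heatKernel_holds (E := EuclideanSpace ℝ (Fin 3)) one_pos).bdd_mul hωc'.aestronglyMeasurable
      (ae_of_all _ fun x => hωB' x))
    refine h.congr (ae_of_all _ fun x => ?_)
    show ⟪curl (W (-1)) x, e3⟫ * heatKernel 1 x = heatKernel 1 x * curl (W (-1)) x 2
    rw [inner_e3_apply, mul_comm]
  have hinth : Integrable (fun y : EuclideanSpace ℝ (Fin 3) => ((y 0) ^ 2 + (y 1) ^ 2) * heatKernel 1 y * curl (W (-1)) y 2) := by
    obtain ⟨hωc', B, hωB'⟩ := omega3_continuous_bounded hW hm1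
    have h2 := ((integrable_norm_sq_mul_heatKernel (E := EuclideanSpace ℝ (Fin 3)) one_pos).bdd_mul hωc'.aestronglyMeasurable
      (ae_of_all _ fun x => hωB' x))
    refine h2.mono ((((((hcont_yi 0).pow 2).add ((hcont_yi 1).pow 2)).mul hG1c).mul (hωc 2))).aestronglyMeasurable
      (ae_of_all _ fun y => ?_)
    have hG : 0 ≤ heatKernel 1 y := (heatKernel_pos one_pos _).le
    have hq : 0 ≤ (y 0) ^ 2 + (y 1) ^ 2 := by positivity
    have hyq : (y 0) ^ 2 + (y 1) ^ 2 ≤ ‖y‖ ^ 2 := Literature.Analysis.FluidPDE.Wei2016.sq_add_sq_le_norm_sq y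
    have he : ⟪curl (W (-1)) y, e3⟫ = curl (W (-1)) y 2 := inner_e3_apply _
    rw [Real.norm_eq_abs, abs_mul, abs_mul, abs_of_nonneg hq, abs_of_nonneg hG, Real.norm_eq_abs, abs_mul, he, abs_mul,
      abs_of_nonneg (sq_nonneg ‖y‖), abs_of_nonneg hG]
    calc ((y 0) ^ 2 + (y 1) ^ 2) * heatKernel 1 y * |curl (W (-1)) y 2| ≤ ‖y‖ ^ 2 * heatKernel 1 y * |curl (W (-1)) y 2| := by
          gcongr
      _ = |curl (W (-1)) y 2| * (‖y‖ ^ 2 * heatKernel 1 y) := by ring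
  have hAbs : |A| ≤ 2 * C * M₀ := by
    have hdom : ∀ y : EuclideanSpace ℝ (Fin 3), ‖heatKernel 1 y * ((y 0 * W (-1) y 0 + y 1 * W (-1) y 1) * curl (W (-1)) y 2)‖ ≤
        C * ((1 / 4) * (((y 0) ^ 2 + (y 1) ^ 2) * heatKernel 1 y * curl (W (-1)) y 2) + (heatKernel 1 y * curl (W (-1)) y 2)) := by
      intro y
      have hG : 0 ≤ heatKernel 1 y := (heatKernel_pos one_pos _).le
      have hω := hω3nn y
      have h1 := abs_horiz_dot_le_quad y (W (-1) y) (hvC y)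
      rw [Real.norm_eq_abs, abs_mul, abs_of_nonneg hG, abs_mul, abs_of_nonneg hω]
      calc heatKernel 1 y * (|y 0 * W (-1) y 0 + y 1 * W (-1) y 1| * curl (W (-1)) y 2)
          ≤ heatKernel 1 y * ((C * ((y 0 ^ 2 + y 1 ^ 2) / 4 + 1)) * curl (W (-1)) y 2) :=
            mul_le_mul_of_nonneg_left (mul_le_mul_of_nonneg_right h1 hω) hG
        _ = C * ((1 / 4) * (((y 0) ^ 2 + (y 1) ^ 2) * heatKernel 1 y * curl (W (-1)) y 2) + (heatKernel 1 y * curl (W (-1)) y 2)) := by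
            ring
    have hintB : Integrable (fun y : EuclideanSpace ℝ (Fin 3) =>
        C * ((1 / 4) * (((y 0) ^ 2 + (y 1) ^ 2) * heatKernel 1 y * curl (W (-1)) y 2) + (heatKernel 1 y * curl (W (-1)) y 2))) :=
      ((hinth.const_mul _).add hint0).const_mul C
    have hnorm := norm_integral_le_of_norm_le hintB (Eventually.of_forall hdom)
    rw [Real.norm_eq_abs] at hnorm
    have hval : ∫ y : EuclideanSpace ℝ (Fin 3),
        C * ((1 / 4) * (((y 0) ^ 2 + (y 1) ^ 2) * heatKernel 1 y * curl (W (-1)) y 2) + (heatKernel 1 y * curl (W (-1)) y 2)) =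
        C * ((1 / 4) * Mh + M₀) := by
      rw [integral_const_mul, integral_add (hinth.const_mul _) hint0, integral_const_mul]
    rw [hval] at hnorm
    calc |A| ≤ C * ((1 / 4) * Mh + M₀) := hnorm
      _ ≤ C * ((1 / 4) * (4 * M₀) + M₀) := by gcongr
      _ = 2 * C * M₀ := by ring
  have hT_eq : T = A + 2 * M₀ := by linarith
  obtain ⟨hAlo, hAhi⟩ := abs_le.1 hAbs
  have hlo : (2 - 2 * C) * M₀ ≤ T := by rw [hT_eq]; nlinarith
  have hhi : T ≤ (2 + 2 * C) * M₀ := by rw [hT_eq]; nlinarith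
  have hrate := hW.1
  have hcont := hW.2.1
  have hmild := hW.2.2.1
  obtain ⟨K₁, -, hK₁⟩ := exists_fderiv_rate_of_class' hrate hcont hmild
  have hAn : AnalyticOnNhd ℝ (W (-1)) univ := analyticOnNhd_slice hcont (bdd_of_hasTypeITimeDecay hrate) hmild hm1
  have hu : ContDiff ℝ 1 (W (-1)) := contDiff_iff_contDiffAt.2 fun x => (hAn x (mem_univ x)).contDiffAt
  have hM : ∀ x, ‖fderiv ℝ (W (-1)) x‖ ≤ K₁ / (-(-1)) := hK₁ (-1) hm1
  obtain ⟨-, -, hE⟩ := gaussTilting_eq_stretching 0 hu hvC hM one_pos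
  have hKS := integral_G_angMom_eq (hu.differentiable one_ne_zero) (hu.continuous_fderiv one_ne_zero) hvC hM one_pos 0
  simp only [sub_zero, mul_one] at hE hKS
  exact ⟨hAT, hAbs, hlo, hhi, hKS, hE⟩

/-- **THE CRUX FROM THE JOINT EXTREMAL SYSTEM (first and second order) for ONE profile.**  To prove `CirculationCarryingRigidity` it
suffices to rule out ONE closed-hemisphere door-class `W` (any constant `C`) carrying SIMULTANEOUSLY: the first-order system (E0)–(E3)
(`firstOrder_of_extremal`), the moment/Hessian/centering package (`moments_of_extremal`), the tilting/stretching package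
(`tilting_of_extremal`), the classical Navier–Stokes form of `∂ₜW`, and the second-order condition `0 ≤ dℐ(−σ;0)[W(σ)]/dσ|_{σ=−1}`
(`…SecondOrder.gaussExtremal_secondOrder`) — all these hold for the Gaussian-extremal profile of any enemy of W6. -/
theorem circulationCarryingRigidity_of_joint
    (h : ∀ (C : ℝ) (W : ℝ → EuclideanSpace ℝ (Fin 3) → EuclideanSpace ℝ (Fin 3)), InDoorClass C W → SignE3 W →
      (0 < heatExtension (fun x => ⟪curl (W (-1)) x, e3⟫) 1 0 ∧
        (∀ y, heatExtension (fun x => ⟪curl (W (-1)) x, e3⟫) 1 y ≤ heatExtension (fun x => ⟪curl (W (-1)) x, e3⟫) 1 0) ∧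
        (∀ t : ℝ, 0 < t → t ≤ 1 →
          t * heatExtension (fun x => ⟪curl (W (-1)) x, e3⟫) t 0 ≤ heatExtension (fun x => ⟪curl (W (-1)) x, e3⟫) 1 0) ∧
        (Δ (heatExtension (fun x => ⟪curl (W (-1)) x, e3⟫) 1)) 0 ≤ 0 ∧
        0 ≤ heatExtension (fun x => ⟪curl (W (-1)) x, e3⟫) 1 0 + (Δ (heatExtension (fun x => ⟪curl (W (-1)) x, e3⟫) 1)) 0 ∧
        gaussInflow 1 0 (W (-1)) = -2 * ((4 * Real.pi) ^ ((3 : ℝ) / 2) * 2 * heatExtension (fun x => ⟪curl (W (-1)) x, e3⟫) 1 0)) →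
      (0 < ∫ y, heatKernel 1 y * curl (W (-1)) y 2 ∧
        (∀ e : EuclideanSpace ℝ (Fin 3),
          ∫ y, ⟪y, e⟫ ^ 2 * heatKernel 1 y * curl (W (-1)) y 2 ≤ 2 * ‖e‖ ^ 2 * ∫ y, heatKernel 1 y * curl (W (-1)) y 2) ∧
        (∀ i : Fin 3, ∫ y, (y i) ^ 2 * heatKernel 1 y * curl (W (-1)) y 2 ≤ 2 * ∫ y, heatKernel 1 y * curl (W (-1)) y 2) ∧
        ∫ y, ((y 0) ^ 2 + (y 1) ^ 2) * heatKernel 1 y * curl (W (-1)) y 2 ≤ 4 * ∫ y, heatKernel 1 y * curl (W (-1)) y 2 ∧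
        2 * ∫ y, heatKernel 1 y * curl (W (-1)) y 2 ≤ ∫ y, ‖y‖ ^ 2 * heatKernel 1 y * curl (W (-1)) y 2 ∧
        ∫ y, ‖y‖ ^ 2 * heatKernel 1 y * curl (W (-1)) y 2 ≤ 6 * ∫ y, heatKernel 1 y * curl (W (-1)) y 2 ∧
        (∀ u : EuclideanSpace ℝ (Fin 3), ∫ y, heatKernel 1 y * ⟪y, u⟫ * curl (W (-1)) y 2 = 0) ∧
        gaussInflow 1 0 (W (-1)) = -2 * ((4 * Real.pi) ^ ((3 : ℝ) / 2) * 2 * ∫ y, heatKernel 1 y * curl (W (-1)) y 2)) →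
      ((∫ y, heatKernel 1 y * ((y 0 * W (-1) y 0 + y 1 * W (-1) y 1) * curl (W (-1)) y 2)) -
            (∫ y, heatKernel 1 y * ((y 0 * curl (W (-1)) y 0 + y 1 * curl (W (-1)) y 1) * W (-1) y 2)) =
          -2 * ∫ y, heatKernel 1 y * curl (W (-1)) y 2 ∧
        |∫ y, heatKernel 1 y * ((y 0 * W (-1) y 0 + y 1 * W (-1) y 1) * curl (W (-1)) y 2)| ≤
          2 * C * ∫ y, heatKernel 1 y * curl (W (-1)) y 2 ∧
        (2 - 2 * C) * ∫ y, heatKernel 1 y * curl (W (-1)) y 2 ≤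
          ∫ y, heatKernel 1 y * ((y 0 * curl (W (-1)) y 0 + y 1 * curl (W (-1)) y 1) * W (-1) y 2) ∧
        ∫ y, heatKernel 1 y * ((y 0 * curl (W (-1)) y 0 + y 1 * curl (W (-1)) y 1) * W (-1) y 2) ≤
          (2 + 2 * C) * ∫ y, heatKernel 1 y * curl (W (-1)) y 2 ∧
        ∫ y, heatKernel 1 y * angMom 0 (W (-1)) y = 2 * ∫ y, heatKernel 1 y * curl (W (-1)) y 2 ∧
        ∫ y, heatKernel 1 y * ((y 0 * curl (W (-1)) y 0 + y 1 * curl (W (-1)) y 1) * W (-1) y 2) =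
          (∫ y, heatKernel 1 y * (angMom 0 (W (-1)) y * fderiv ℝ (W (-1)) y (EuclideanSpace.single 2 1) 2)) -
            1 / 2 * ∫ y, heatKernel 1 y * (y 2 * W (-1) y 2 * angMom 0 (W (-1)) y)) →
      (∃ p : ℝ → EuclideanSpace ℝ (Fin 3) → ℝ, IsClassicalNSSolutionOn (Iio (0 : ℝ)) 1 0 W p ∧
        ∀ s < (0 : ℝ), ∀ x, deriv (fun τ => W τ x) s = (Δ (W s)) x - convect (W s) (W s) x - gradient (p s) x) →
      0 ≤ (4 * Real.pi) ^ ((3 : ℝ) / 2) *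
          ∫ x, (-((‖x - 0‖ ^ 2 / (4 * (0 - (-1 : ℝ)) ^ 2) - (3 : ℝ) / (2 * (0 - (-1 : ℝ)))) * heatKernel (0 - (-1 : ℝ)) (x - 0)) *
              (⟪x - 0, W (-1) x⟫ * angMom 0 (W (-1)) x) +
            heatKernel (0 - (-1 : ℝ)) (x - 0) *
              (⟪x - 0, deriv (fun τ => W τ x) (-1)⟫ * angMom 0 (W (-1)) x +
                ⟪x - 0, W (-1) x⟫ * ((x - 0) 0 * deriv (fun τ => W τ x) (-1) 1 - (x - 0) 1 * deriv (fun τ => W τ x) (-1) 0))) →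
      False) :
    CirculationCarryingRigidity := by
  refine circulationCarryingRigidity_of_hemisphereLiouvilleE3 ?_
  intro C v hrate hcont hmild hdiv hsign s hs y
  by_contra hne
  have hpos : 0 < ⟪curl (v s) y, e3⟫ := lt_of_le_of_ne (hsign s hs y) (Ne.symm hne)
  obtain ⟨W, hW, hWs, hΛ, hmax, hI, hp, -, h2⟩ :=
    gaussExtremal_secondOrder (C := C) ⟨hrate, hcont, hmild, hdiv⟩ hsign ⟨s, hs, y, hpos⟩
  exact h C W hW hWs (firstOrder_of_extremal hW hΛ hmax hI) (moments_of_extremal hW hΛ hmax hI)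
    (tilting_of_extremal hW hWs hΛ hmax hI) hp h2

end Summit.NavierStokesRegularity.NavierStokesRegularity.Theorems.HalfSpaceWindowDoorCirculationCarryingRigidityGaussExtremalJoint

end
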